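import Mathlib
import Literature.RingTheory.TwoVariableSeries.Basic
import Summits.ResolutionOfSingularities.ResolutionOfSingularities.Theorems.WeightedInvariantLocalWeightedDropMonicDescentDissolveSeq
import Summits.ResolutionOfSingularities.ResolutionOfSingularities.Theorems.WeightedInvariantLocalWeightedDropMonicDescentStrategy

/-!
# `WeightedInvariant.LocalWeightedDrop`, sub-stub N4″: WELL-PREPARING RE-CENTRINGS EXIST — the u-adic limit of vertex dissolution (piece T-1′)

Crux item stmt-ResolutionOfSingularities-8899 `LocalWeightedDrop` (route `ResolutionOfSingularities/WeightedInvariant`), door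
`WeightedConstruction` stmt-ResolutionOfSingularities-0571.  [OURS · L1 W4.3, chain w43, lead prover; piece T-1′ (`stub_monicDescentPrep` of the line under the registered
stub `stub_monicDoublePointDescends`) of `N4PRIME-PLAN.md` §10, steps (d4)–(d6).  MODEL: Hironaka's vertex preparation in the complete case
(Cossart–Jannsen–Saito LNM 2270 Ch. 8): dissolve solvable vertices by least degree; the dissolved vertices never reappear, so their degrees tend to infinity and
the re-centrings converge `u`-adically; the limit label has no solvable vertex.]

* `eventually_degree_dvert_gt` — for every `D`, from some stage on every dissolved vertex has degree `> D` (dissolved vertices are pairwise distinct);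
* `stabN`, `coeff_dpsi_stable`, `coeff_dseq_stable` — coefficientwise stabilisation; `psiLim`, `bLim` — the limits; `bLim_eq_recentre`;
* `wellPrepared_bLim`, `isPosition_bLim`, `oddVertex_bLim` — the limit label is a well-prepared position and keeps the odd vertices with their coefficients;
* `monicDescentPrep` — T-1′: every position over an algebraically closed field of characteristic 2 has a well-preparing re-centring (`IsPrepRecentring`).
-/

set_option linter.dupNamespace false -- mandated namespace of this single-conjunct summit

noncomputable section

namespace Summit.ResolutionOfSingularities.ResolutionOfSingularities.Theorems

namespace MonicDescent

open MvPowerSeries Literature.RingTheory.TwoVariableSeries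

attribute [local instance] Classical.propDecidable

variable {k : Type} [Field k] [IsAlgClosed k] [CharP k 2]

omit [CharP k 2] in
/-- At an active stage the half-vertex `e_n` has `e₀ + e₁ ≥ 2` and `2·deg e_n = deg v_n`. -/
theorem two_le_half_dvert {A₀ A₁ : MvPowerSeries (Fin 2) k} (hA : IsPosition A₀ A₁) {n : ℕ} (h : DActive A₀ A₁ n) :
    2 ≤ half (dvert A₁ (dseq A₀ A₁ n)) 0 + half (dvert A₁ (dseq A₀ A₁ n)) 1 ∧
    Finsupp.degree (dvert A₁ (dseq A₀ A₁ n)) = 2 * (half (dvert A₁ (dseq A₀ A₁ n)) 0 + half (dvert A₁ (dseq A₀ A₁ n)) 1) := by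
  obtain ⟨hP, -, -, hmem, -⟩ := dactive_spec h
  have h3 := three_le_sum_of_isPosition (isPosition_dseq hA n) _ hmem
  simp only [Finsupp.smul_apply, smul_eq_mul] at h3
  refine ⟨by omega, ?_⟩
  rw [Finsupp.degree_eq_sum, Fin.sum_univ_two]
  conv_lhs => rw [hP]
  simp only [Finsupp.smul_apply, smul_eq_mul]
  ring

/-- EVENTUALLY LARGE: for every `D`, from some stage on every dissolved vertex has degree `> D`. -/
theorem eventually_degree_dvert_gt (A₀ A₁ : MvPowerSeries (Fin 2) k) (D : ℕ) :
    ∃ N, ∀ n, N ≤ n → DActive A₀ A₁ n → D < Finsupp.degree (dvert A₁ (dseq A₀ A₁ n)) := by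
  set T : Set ℕ := {n | DActive A₀ A₁ n ∧ Finsupp.degree (dvert A₁ (dseq A₀ A₁ n)) ≤ D} with hT
  have hinj : Set.InjOn (fun n => dvert A₁ (dseq A₀ A₁ n)) T := by
    intro n hn m hm heq
    by_contra hne
    rcases Nat.lt_or_gt_of_ne hne with hlt | hlt
    · exact dvert_ne_of_lt hn.1 hm.1 hlt heq
    · exact dvert_ne_of_lt hm.1 hn.1 hlt heq.symm
  have himg : ((fun n => dvert A₁ (dseq A₀ A₁ n)) '' T).Finite := by
    refine (Finset.finite_toSet (Finset.Iic (Finsupp.single 0 D + Finsupp.single 1 D : Fin 2 →₀ ℕ))).subset ?_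
    rintro P ⟨n, hn, rfl⟩
    rw [Finset.mem_coe, Finset.mem_Iic]
    have hdeg := hn.2
    rw [Finsupp.degree_eq_sum, Fin.sum_univ_two] at hdeg
    intro i
    fin_cases i <;> simp <;> omega
  have hfin : T.Finite := Set.Finite.of_finite_image himg hinj
  obtain ⟨M, hM⟩ := hfin.bddAbove
  refine ⟨M + 1, fun n hn hact => ?_⟩
  by_contra hle
  push Not at hle
  have : n ∈ T := ⟨hact, hle⟩
  have := hM this
  omega

/-- The stabilisation index for the coefficient at `d`. -/
def stabN (A₀ A₁ : MvPowerSeries (Fin 2) k) (d : Fin 2 →₀ ℕ) : ℕ :=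
  Classical.choose (eventually_degree_dvert_gt A₀ A₁ (2 * Finsupp.degree d))

/-- Beyond `stabN d`, active stages dissolve at `e_n` of degree `> deg d`. -/
theorem degree_half_gt_of_stabN_le {A₀ A₁ : MvPowerSeries (Fin 2) k} (hA : IsPosition A₀ A₁) {d : Fin 2 →₀ ℕ} {n : ℕ}
    (hn : stabN A₀ A₁ d ≤ n) (hact : DActive A₀ A₁ n) :
    d 0 + d 1 < half (dvert A₁ (dseq A₀ A₁ n)) 0 + half (dvert A₁ (dseq A₀ A₁ n)) 1 := by
  have h := Classical.choose_spec (eventually_degree_dvert_gt A₀ A₁ (2 * Finsupp.degree d)) n hn hact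
  obtain ⟨-, hdeg⟩ := two_le_half_dvert hA hact
  rw [hdeg, Finsupp.degree_eq_sum, Fin.sum_univ_two] at h
  omega

/-- COEFFICIENTS OF THE RE-CENTRINGS STABILISE. -/
theorem coeff_dpsi_stable {A₀ A₁ : MvPowerSeries (Fin 2) k} (hA : IsPosition A₀ A₁) (d : Fin 2 →₀ ℕ) (n : ℕ) (hn : stabN A₀ A₁ d ≤ n) :
    coeff d (dpsi A₀ A₁ n) = coeff d (dpsi A₀ A₁ (stabN A₀ A₁ d)) := by
  induction n, hn using Nat.le_induction with
  | base => rfl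
  | succ n hmn ih =>
    rw [dpsi_succ, map_add, ih]
    by_cases hact : DActive A₀ A₁ n
    · rw [dinc_of_exists hact, coeff_monomial, if_neg, add_zero]
      intro heq
      have := degree_half_gt_of_stabN_le hA hmn hact
      rw [← heq] at this
      omega
    · rw [dinc_of_not hact, map_zero, add_zero]

/-- COEFFICIENTS OF THE FIRST COMPONENTS STABILISE. -/
theorem coeff_dseq_stable {A₀ A₁ : MvPowerSeries (Fin 2) k} (hA : IsPosition A₀ A₁) (d : Fin 2 →₀ ℕ) (n : ℕ) (hn : stabN A₀ A₁ d ≤ n) :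
    coeff d (dseq A₀ A₁ n) = coeff d (dseq A₀ A₁ (stabN A₀ A₁ d)) := by
  induction n, hn using Nat.le_induction with
  | base => rfl
  | succ n hmn ih =>
    rw [← ih]
    by_cases hact : DActive A₀ A₁ n
    · obtain ⟨-, -, -, -, hstep⟩ := dactive_spec hact
      rw [hstep]
      have hlt := degree_half_gt_of_stabN_le hA hmn hact
      apply coeff_dissolveFst_eq_of_not
      · intro heq
        have h0 := congrArg (fun f : Fin 2 →₀ ℕ => f 0) heq
        have h1 := congrArg (fun f : Fin 2 →₀ ℕ => f 1) heq
        simp only [Finsupp.smul_apply, smul_eq_mul] at h0 h1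
        omega
      · intro a _ heq
        have h0 := congrArg (fun f : Fin 2 →₀ ℕ => f 0) heq
        have h1 := congrArg (fun f : Fin 2 →₀ ℕ => f 1) heq
        simp only [Finsupp.add_apply] at h0 h1
        omega
    · rw [dseq_succ, dnext_of_not hact]

/-- THE LIMIT RE-CENTRING. -/
def psiLim (A₀ A₁ : MvPowerSeries (Fin 2) k) : MvPowerSeries (Fin 2) k :=
  fun d => coeff d (dpsi A₀ A₁ (stabN A₀ A₁ d))

/-- THE LIMIT FIRST COMPONENT. -/
def bLim (A₀ A₁ : MvPowerSeries (Fin 2) k) : MvPowerSeries (Fin 2) k :=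
  fun d => coeff d (dseq A₀ A₁ (stabN A₀ A₁ d))

/-- The limit re-centring agrees with all late stages. -/
theorem coeff_psiLim {A₀ A₁ : MvPowerSeries (Fin 2) k} (hA : IsPosition A₀ A₁) (d : Fin 2 →₀ ℕ) (n : ℕ) (hn : stabN A₀ A₁ d ≤ n) :
    coeff d (psiLim A₀ A₁) = coeff d (dpsi A₀ A₁ n) := by
  rw [coeff_dpsi_stable hA d n hn]; rfl

/-- The limit first component agrees with all late stages. -/
theorem coeff_bLim {A₀ A₁ : MvPowerSeries (Fin 2) k} (hA : IsPosition A₀ A₁) (d : Fin 2 →₀ ℕ) (n : ℕ) (hn : stabN A₀ A₁ d ≤ n) :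
    coeff d (bLim A₀ A₁) = coeff d (dseq A₀ A₁ n) := by
  rw [coeff_dseq_stable hA d n hn]; rfl

/-- The stage from which on the limits agree with the stages on all lattice points `≤ D` (pointwise). -/
def stageOf (A₀ A₁ : MvPowerSeries (Fin 2) k) (D : Fin 2 →₀ ℕ) : ℕ := (Finset.Iic D).sup (stabN A₀ A₁)

/-- Agreement of the limits with every stage `≥ stageOf D` on all points `≤ D`. -/
theorem agree_of_stageOf_le {A₀ A₁ : MvPowerSeries (Fin 2) k} (hA : IsPosition A₀ A₁) (D : Fin 2 →₀ ℕ) (n : ℕ) (hn : stageOf A₀ A₁ D ≤ n) :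
    ∀ f ≤ D, coeff f (psiLim A₀ A₁) = coeff f (dpsi A₀ A₁ n) ∧ coeff f (bLim A₀ A₁) = coeff f (dseq A₀ A₁ n) := by
  intro f hf
  have hle : stabN A₀ A₁ f ≤ n := le_trans (Finset.le_sup (f := stabN A₀ A₁) (Finset.mem_Iic.mpr hf)) hn
  exact ⟨coeff_psiLim hA f _ hle, coeff_bLim hA f _ hle⟩

omit [IsAlgClosed k] [CharP k 2] in
/-- The coefficient of a re-centred first component at `d` depends only on the coefficients of `ψ` at points `≤ d`. -/
theorem coeff_recentre_congr (A₀ A₁ ψ ψ' : MvPowerSeries (Fin 2) k) (d : Fin 2 →₀ ℕ) (h : ∀ f ≤ d, coeff f ψ = coeff f ψ') :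
    coeff d (A₀ + A₁ * ψ + ψ ^ 2) = coeff d (A₀ + A₁ * ψ' + ψ' ^ 2) := by
  simp only [map_add, pow_two, coeff_mul]
  congr 1
  · congr 1
    refine Finset.sum_congr rfl fun p hp => ?_
    rw [Finset.HasAntidiagonal.mem_antidiagonal] at hp
    rw [h p.2 (by rw [← hp]; exact le_add_self)]
  · refine Finset.sum_congr rfl fun p hp => ?_
    rw [Finset.HasAntidiagonal.mem_antidiagonal] at hp
    rw [h p.1 (by rw [← hp]; exact le_self_add), h p.2 (by rw [← hp]; exact le_add_self)]

/-- THE LIMIT IS THE RE-CENTRING BY THE LIMIT: `bLim = A₀ + A₁·ψ + ψ²`. -/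
theorem bLim_eq_recentre {A₀ A₁ : MvPowerSeries (Fin 2) k} (hA : IsPosition A₀ A₁) :
    bLim A₀ A₁ = A₀ + A₁ * psiLim A₀ A₁ + psiLim A₀ A₁ ^ 2 := by
  ext d
  have hn := agree_of_stageOf_le hA d _ le_rfl
  rw [(hn d le_rfl).2, dseq_eq_recentre, coeff_recentre_congr A₀ A₁ _ (psiLim A₀ A₁) d (fun f hf => ((hn f hf).1).symm)]

/-- The limit re-centring has zero constant term. -/
theorem constantCoeff_psiLim {A₀ A₁ : MvPowerSeries (Fin 2) k} (hA : IsPosition A₀ A₁) : constantCoeff (psiLim A₀ A₁) = 0 := by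
  have hzero : ∀ n, coeff (0 : Fin 2 →₀ ℕ) (dpsi A₀ A₁ n) = 0 := by
    intro n
    induction n with
    | zero => simp
    | succ n ih =>
      rw [dpsi_succ, map_add, ih, zero_add]
      by_cases hact : DActive A₀ A₁ n
      · rw [dinc_of_exists hact, coeff_monomial, if_neg]
        intro heq
        have := (two_le_half_dvert hA hact).1
        rw [← heq] at this
        simp at this
      · rw [dinc_of_not hact, map_zero]
  rw [← coeff_zero_eq_constantCoeff_apply, coeff_psiLim hA 0 _ le_rfl, hzero]

/-- THE LIMIT LABEL IS A POSITION. -/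
theorem isPosition_bLim {A₀ A₁ : MvPowerSeries (Fin 2) k} (hA : IsPosition A₀ A₁) : IsPosition (bLim A₀ A₁) A₁ := by
  refine ⟨lt_of_lt_of_le (by exact_mod_cast (by norm_num : (2 : ℕ) < 3)) (MvPowerSeries.le_order (n := ((3 : ℕ) : ℕ∞)) fun d hd => ?_), hA.2⟩
  rw [coeff_bLim hA d _ le_rfl]
  apply coeff_of_lt_order
  refine lt_of_le_of_lt ?_ (isPosition_dseq hA _).1
  have : Finsupp.degree d ≤ 2 := by have := Nat.cast_lt.mp hd; omega
  exact_mod_cast this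

/-- THE LIMIT LABEL IS WELL PREPARED: an even vertex of the limit would be an even vertex of every late stage, of fixed degree — but the schedule dissolves
vertices of least degree and those degrees tend to infinity. -/
theorem wellPrepared_bLim {A₀ A₁ : MvPowerSeries (Fin 2) k} (hA : IsPosition A₀ A₁) : WellPrepared (bLim A₀ A₁) A₁ := by
  intro v hv
  by_contra hodd
  obtain ⟨hvmem, w, hw, hmin⟩ := hv
  set L := Finsupp.weight w v with hL
  obtain ⟨N, hN⟩ := eventually_degree_dvert_gt A₀ A₁ (Finsupp.degree v)
  set n := max (stageOf A₀ A₁ (Finsupp.single 0 L + Finsupp.single 1 L)) N with hn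
  have hwt : ∀ Q : Fin 2 →₀ ℕ, Finsupp.weight w Q = w 0 * Q 0 + w 1 * Q 1 := by
    intro Q; rw [Finsupp.weight_apply, Finsupp.sum_fintype _ _ (by simp)]; simp [Fin.sum_univ_two, mul_comm]
  have hsmall : ∀ Q : Fin 2 →₀ ℕ, Finsupp.weight w Q ≤ L → Q ≤ Finsupp.single 0 L + Finsupp.single 1 L := by
    intro Q hQ i
    have h0 := hw 0; have h1 := hw 1
    rw [hwt] at hQ
    fin_cases i <;> simp <;> nlinarith
  have hagree : ∀ Q : Fin 2 →₀ ℕ, Finsupp.weight w Q ≤ L → coeff Q (bLim A₀ A₁) = coeff Q (dseq A₀ A₁ n) :=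
    fun Q hQ => (agree_of_stageOf_le hA _ n (le_max_left _ _) Q (hsmall Q hQ)).2
  -- `v` is an even vertex of stage `n`
  have hvn : v ∈ newtonSet (dseq A₀ A₁ n) A₁ := by
    rcases hvmem with hv0 | ⟨e, rfl, he⟩
    · left; change coeff v (bLim A₀ A₁) ≠ 0 at hv0; change coeff v (dseq A₀ A₁ n) ≠ 0
      rwa [← hagree v le_rfl]
    · exact Or.inr ⟨e, rfl, he⟩
  have hminn : ∀ Q ∈ newtonSet (dseq A₀ A₁ n) A₁, Q ≠ v → Finsupp.weight w v < Finsupp.weight w Q := by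
    intro Q hQ hQv
    by_contra hle
    push Not at hle
    have hQlim : Q ∈ newtonSet (bLim A₀ A₁) A₁ := by
      rcases hQ with hQ0 | ⟨e, rfl, he⟩
      · left; change coeff Q (dseq A₀ A₁ n) ≠ 0 at hQ0; change coeff Q (bLim A₀ A₁) ≠ 0
        rwa [hagree Q hle]
      · exact Or.inr ⟨e, rfl, he⟩
    exact absurd (hmin Q hQlim hQv) (not_lt.mpr hle)
  have heven : ¬ IsOdd (dseq A₀ A₁ n) A₁ v := by
    intro h
    apply hodd
    rcases h with h | ⟨hc, hi⟩
    · exact Or.inl h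
    · refine Or.inr ⟨?_, hi⟩
      rwa [hagree v le_rfl]
  have hev : IsEvenVertex (dseq A₀ A₁ n) A₁ v := ⟨⟨hvn, w, hw, hminn⟩, heven⟩
  have hact : DActive A₀ A₁ n := ⟨v, hev⟩
  have hle := (dvert_spec hact).2 v hev
  have hgt := hN n (le_max_right _ _) hact
  omega

/-- ODD VERTICES OF THE ORIGINAL LABEL PERSIST in the limit, with their `A₀`-coefficient. -/
theorem oddVertex_bLim {A₀ A₁ : MvPowerSeries (Fin 2) k} (hA : IsPosition A₀ A₁) {P : Fin 2 →₀ ℕ}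
    (hPv : IsVertex (newtonSet A₀ A₁) P) (hPodd : IsOdd A₀ A₁ P) :
    IsVertex (newtonSet (bLim A₀ A₁) A₁) P ∧ coeff P (bLim A₀ A₁) = coeff P A₀ := by
  obtain ⟨hPmem, w, hw, hmin⟩ := hPv
  have hstage := fun n => oddVertex_dseq hPodd hPmem w hmin n (A₁ := A₁)
  have hcoef : coeff P (bLim A₀ A₁) = coeff P A₀ := by
    rw [coeff_bLim hA P _ le_rfl]; exact (hstage _).1
  refine ⟨⟨?_, w, hw, fun Q hQ hQP => ?_⟩, hcoef⟩
  · rcases hPmem with hP0 | ⟨e, rfl, he⟩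
    · left; change coeff P (bLim A₀ A₁) ≠ 0; rw [hcoef]; exact hP0
    · exact Or.inr ⟨e, rfl, he⟩
  · have hQn : Q ∈ newtonSet (dseq A₀ A₁ (stabN A₀ A₁ Q)) A₁ := by
      rcases hQ with hQ0 | ⟨e, rfl, he⟩
      · left; change coeff Q (bLim A₀ A₁) ≠ 0 at hQ0; change coeff Q (dseq A₀ A₁ (stabN A₀ A₁ Q)) ≠ 0
        rwa [← coeff_bLim hA Q _ le_rfl]
      · exact Or.inr ⟨e, rfl, he⟩
    exact (hstage _).2.2 Q hQn hQP

omit [IsAlgClosed k] [CharP k 2] in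
/-- PIECE T-1′: over an algebraically closed field of characteristic 2, EVERY POSITION HAS A WELL-PREPARING RE-CENTRING (the `u`-adic limit of vertex
dissolution scheduled by least degree).  This is the hypothesis `hT1` of `descends_of_pieces`, `betaL_succLabels_le`, `monicDescentNoChain`. -/
theorem monicDescentPrep :
    ∀ (k : Type) [Field k] [CharP k 2] [IsAlgClosed k] (A₀ A₁ : MvPowerSeries (Fin 2) k),
      IsPosition A₀ A₁ → ∃ ψ : MvPowerSeries (Fin 2) k, IsPrepRecentring A₀ A₁ ψ := by
  intro k _ _ _ A₀ A₁ hA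
  refine ⟨psiLim A₀ A₁, constantCoeff_psiLim hA, ?_⟩
  have h1 : (recentre (psiLim A₀ A₁) A₀ A₁).1 = bLim A₀ A₁ := (bLim_eq_recentre hA).symm
  have h2 : (recentre (psiLim A₀ A₁) A₀ A₁).2 = A₁ := recentre_snd_eq _ _ _
  rw [h1, h2]
  exact ⟨isPosition_bLim hA, wellPrepared_bLim hA, fun P hPv hPodd => oddVertex_bLim hA hPv hPodd⟩

end MonicDescent

end Summit.ResolutionOfSingularities.ResolutionOfSingularities.Theorems

end
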